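import Mathlib

/-!
# Sketch (stub-ideation k4 g25, family 3 «assume the opposite», event-armed on the Q140 trigger «S3Body landing»:
# p717288 `Theorems/…ResidualSignedLambdaLowerCMAtTwoS3BodyOfStations.lean` (56355f03460fa9b8) + the LEAD's v3f plan (bus 12:08:20Z)
# + w2's `desc_station` announcement (bus 12:17:30Z)) — AUTOMATIC `ℤ₂`-LINEARITY: station (E)'s bare additive typing is enough for (DESC)

Crux `ResidualThetaCountLowerPureAtTwo` (stmt-BirchSwinnertonDyer-26074), stub `stub_cmLambdaLower` = RSL_g
(stmt-BirchSwinnertonDyer-22608, text verbatim in `Lines/bt26_lambda.lean` v7, never re-typed here). THEOREMS ONLY: no `sorry`, no definitions,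
no instances, no notation. BSD is proved for no curve by any of this; 22608 / 26074 stay OPEN, 24105 (S3″) stays on HOLD.

OPPOSITE UNDER THE KNIFE. In `s3body_of_stations` (p717288) station (E) binds the trivialisation as a BARE ADDITIVE equivalence
`e : (Fin n → ℤ_[2]⟦X⟧) ≃+ IwasawaAlgebraO S` (+ `hlin` on the line `Λ_𝒪 z₀`), while the announced supplier of station (DESC),
`desc_station π e he` (w2, bus 12:17:30Z), and the landed supplier of station (R), `hERL_of_mazurTateValues_at … e he …` (p715483), bind the
SAME `e` with its full `map ι`-semilinearity `he : ∀ r t, e (r • t) = PowerSeries.map ι r * e t`. «So the station list of p717288 is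
incoherent with its suppliers: (E) as typed is too weak, and an additive `e` that is not `ℤ₂`-linear breaks the two-currency count.»
LEDGER (card §1): the `ℤ₂`-PART of `he` is AUTOMATIC — every additive map between `ℤ_[p]`-modules whose target has no non-zero infinitely
`p`-divisible element is `ℤ_[p]`-linear (§2; the tree's `Literature.Algebra.Module.PadicAdditiveMapsLinear` has this for `Module.Finite` /
`ℤ_[p]`-valued targets; §3 adds the NON-finite power-series targets `A⟦X⟧`, `ℤ_[p]⟦X⟧ⁿ` of the line, §4 the corollary in (E)'s literal shape);
the `X`-PART is NOT automatic (k3-g12 §4's additive counterexample) and IS load-bearing — in (R) (moving `ω_{2m}`-multiples through `e`) and in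
w2's route to (DESC) (`e (span 𝒸(Λ_𝒪 z)) ⊆ (h)` by span induction); the alternative route to (DESC) replaces it by H8 (`𝒸` is `Λ`-linear,
k4-g20 sketch, port owed), under which `span (𝒸 '' Λ_𝒪 z) = 𝒸 (Λ_𝒪 z)` and only the automatic `ℤ₂`-part is used. Net: the opposite is
REFUTED (no incoherence: s3body moves scalars through `e` only on the line, via `hlin`), and v3f's `stub_kzgTrivialisation` must export the FULL
`he` for (R) regardless — 0 text change, 0 owed.
-/

set_option autoImplicit false
set_option linter.dupNamespace false
set_option linter.unusedSectionVars false

namespace Summit.BirchSwinnertonDyer.BirchSwinnertonDyer.Cruxes.ResidualThetaCountLowerPureAtTwo.SideaK4G25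

variable {p : ℕ} [Fact p.Prime]

/-! ## §1 `ℤ` is dense enough: `a = m + p^k · b` with `m ∈ ℕ` -/

/-- Every `p`-adic integer is a natural number plus a multiple of `p ^ k` (`PadicInt.appr`). -/
theorem exists_nat_add_pow_mul (k : ℕ) (a : ℤ_[p]) : ∃ (m : ℕ) (b : ℤ_[p]), a = (m : ℤ_[p]) + (p : ℤ_[p]) ^ k * b := by
  obtain ⟨b, hb⟩ := Ideal.mem_span_singleton.mp (PadicInt.appr_spec k a)
  exact ⟨PadicInt.appr a k, b, by rw [← hb]; ring⟩

/-! ## §2 Automatic `ℤ_[p]`-linearity of additive maps into `p`-adically separated targets -/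

section AutoLinear

variable {M N : Type*} [AddCommGroup M] [Module ℤ_[p] M] [AddCommGroup N] [Module ℤ_[p] N]

/-- **Automatic linearity.** If the target `N` has no non-zero element divisible by every power of `p` (e.g. any finitely generated module
over a Noetherian local `ℤ_[p]`-algebra with `p` in the maximal ideal — Krull), then EVERY additive map `φ : M →+ N` of `ℤ_[p]`-modules is
`ℤ_[p]`-linear. Proof: with `a = m + p^k b` (§1), `φ (a • x) − a • φ x = p^k • (φ (b • x) − b • φ x)` for every `k`.
[cite: Washington1997, §13.2] -/
theorem map_smul_of_addMonoidHom (hN : ∀ y : N, (∀ k : ℕ, ∃ w : N, y = ((p : ℤ_[p]) ^ k) • w) → y = 0)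
    (φ : M →+ N) (a : ℤ_[p]) (x : M) : φ (a • x) = a • φ x := by
  rw [← sub_eq_zero]
  apply hN
  intro k
  obtain ⟨m, b, rfl⟩ := exists_nat_add_pow_mul k a
  refine ⟨φ (b • x) - b • φ x, ?_⟩
  have h1 : φ (((m : ℤ_[p]) + (p : ℤ_[p]) ^ k * b) • x) = (m : ℤ_[p]) • φ x + ((p : ℤ_[p]) ^ k) • φ (b • x) := by
    rw [add_smul, map_add, mul_smul]
    congr 1
    · rw [Nat.cast_smul_eq_nsmul ℤ_[p] m x, map_nsmul, Nat.cast_smul_eq_nsmul]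
    · rw [← Nat.cast_pow, Nat.cast_smul_eq_nsmul ℤ_[p] (p ^ k) (b • x), map_nsmul, Nat.cast_smul_eq_nsmul]
  rw [h1, add_smul, mul_smul, smul_sub]
  abel

/-- The same, packaged: an additive map into a separated target IS (the coercion of) a `ℤ_[p]`-linear map. -/
theorem exists_linearMap_of_addMonoidHom (hN : ∀ y : N, (∀ k : ℕ, ∃ w : N, y = ((p : ℤ_[p]) ^ k) • w) → y = 0)
    (φ : M →+ N) : ∃ ψ : M →ₗ[ℤ_[p]] N, ∀ x, ψ x = φ x :=
  ⟨{ toFun := φ, map_add' := φ.map_add, map_smul' := fun a x ↦ map_smul_of_addMonoidHom hN φ a x }, fun _ ↦ rfl⟩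

end AutoLinear

/-! ## §3 The targets of the line are separated: `ℤ_[p]`, products, power series -/

/-- `ℤ_[p]` has no non-zero infinitely `p`-divisible element. -/
theorem padicInt_separated (y : ℤ_[p]) (hy : ∀ k : ℕ, ∃ w : ℤ_[p], y = ((p : ℤ_[p]) ^ k) • w) : y = 0 := by
  by_contra h0
  have hpos : 0 < ‖y‖ := norm_pos_iff.mpr h0
  have hp1 : (1 : ℝ) < p := by exact_mod_cast (Fact.out : p.Prime).one_lt
  obtain ⟨k, hk⟩ := exists_pow_lt_of_lt_one hpos (inv_lt_one_of_one_lt₀ hp1)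
  obtain ⟨w, hw⟩ := hy k
  have hle : ‖y‖ ≤ (p : ℝ) ^ (-k : ℤ) := by
    rw [PadicInt.norm_le_pow_iff_mem_span_pow]
    exact Ideal.mem_span_singleton.mpr ⟨w, by rw [hw, smul_eq_mul]⟩
  rw [zpow_neg, zpow_natCast, ← inv_pow] at hle
  exact absurd (hle.trans_lt hk) (lt_irrefl _)

/-- Products of separated targets are separated. -/
theorem pi_separated {ι : Type*} {N : ι → Type*} [∀ i, AddCommGroup (N i)] [∀ i, Module ℤ_[p] (N i)]
    (hN : ∀ i (y : N i), (∀ k : ℕ, ∃ w : N i, y = ((p : ℤ_[p]) ^ k) • w) → y = 0)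
    (y : ∀ i, N i) (hy : ∀ k : ℕ, ∃ w : ∀ i, N i, y = ((p : ℤ_[p]) ^ k) • w) : y = 0 := by
  funext i
  refine hN i (y i) fun k ↦ ?_
  obtain ⟨w, hw⟩ := hy k
  exact ⟨w i, by rw [hw, Pi.smul_apply]⟩

/-- Power-series modules over a separated coefficient module are separated (coefficientwise). -/
theorem powerSeries_separated {A : Type*} [CommRing A] [Module ℤ_[p] A]
    (hA : ∀ y : A, (∀ k : ℕ, ∃ w : A, y = ((p : ℤ_[p]) ^ k) • w) → y = 0)
    (y : PowerSeries A) (hy : ∀ k : ℕ, ∃ w : PowerSeries A, y = ((p : ℤ_[p]) ^ k) • w) : y = 0 := by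
  ext m
  rw [map_zero]
  refine hA _ fun k ↦ ?_
  obtain ⟨w, hw⟩ := hy k
  exact ⟨PowerSeries.coeff m w, by rw [hw, PowerSeries.coeff_smul]⟩

/-! ## §4 Corollary in station (E)'s literal shape -/

/-- **(E) ⇒ the `ℤ₂`-part of `he`, for free.** Any ADDITIVE map `e : (Fin n → ℤ_[p]⟦X⟧) →+ A⟦X⟧` into power series over a separated
`ℤ_[p]`-module of coefficients `A` (the line: `A = 𝒪 = coeffO S`, a finite free `ℤ₂`-module) is `ℤ_[p]`-linear — so the two-currency count of
station (DESC), which transports `λ_{ℤ₂}` along `e` (w2's `desc_station`, step (2), uses exactly `ℤ₂`-linearity), is available from (E) AS TYPED in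
`s3body_of_stations` (bare `≃+`), the `X`-compatibility being supplied not by `e` but by the `Λ`-linearity of `𝒸` (H8): `span (𝒸 '' Λ_𝒪 z) = 𝒸(Λ_𝒪 z)`.
[cite: Kato2004Asterisque, Thm. 12.5 (1) (p. 221)] [cite: Washington1997, §13.2] -/
theorem trivialisation_map_smul {n : ℕ} {A : Type*} [CommRing A] [Module ℤ_[p] A]
    (hA : ∀ y : A, (∀ k : ℕ, ∃ w : A, y = ((p : ℤ_[p]) ^ k) • w) → y = 0)
    (e : (Fin n → PowerSeries ℤ_[p]) →+ PowerSeries A) (r : ℤ_[p]) (t : Fin n → PowerSeries ℤ_[p]) :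
    e (r • t) = r • e t :=
  map_smul_of_addMonoidHom (powerSeries_separated hA) e r t

/-- The model case `A = ℤ_[p]` (coefficients `𝒪 = ℤ₂`, `f = 1`): every additive self-map of `ℤ_[p]⟦X⟧ⁿ → ℤ_[p]⟦X⟧` is `ℤ_[p]`-linear. -/
theorem trivialisation_map_smul_padicInt {n : ℕ} (e : (Fin n → PowerSeries ℤ_[p]) →+ PowerSeries ℤ_[p])
    (r : ℤ_[p]) (t : Fin n → PowerSeries ℤ_[p]) : e (r • t) = r • e t :=
  trivialisation_map_smul (fun y hy ↦ padicInt_separated y hy) e r t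

/-- And additive maps between the SOURCE modules themselves (`ℤ_[p]⟦X⟧ⁿ`, e.g. `e.symm ∘ e'` for two trivialisations) are `ℤ_[p]`-linear. -/
theorem pi_powerSeries_map_smul {n m : ℕ} (φ : (Fin n → PowerSeries ℤ_[p]) →+ (Fin m → PowerSeries ℤ_[p]))
    (r : ℤ_[p]) (t : Fin n → PowerSeries ℤ_[p]) : φ (r • t) = r • φ t :=
  map_smul_of_addMonoidHom
    (pi_separated (fun _ y hy ↦ powerSeries_separated (fun y hy ↦ padicInt_separated y hy) y hy)) φ r t

end Summit.BirchSwinnertonDyer.BirchSwinnertonDyer.Cruxes.ResidualThetaCountLowerPureAtTwo.SideaK4G25
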